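import Mathlib
import HarnessLib
import Summits.HubbardSuperconductivity.HubbardSuperconductivity.Theorems.KLProgrammeKLRegimeEngineTowerBlockIncrWtRate
import Summits.HubbardSuperconductivity.HubbardSuperconductivity.Theorems.KLProgrammeKLRegimeAlphaWtBlockTower
import Summits.HubbardSuperconductivity.HubbardSuperconductivity.Theorems.KLProgrammeKLRegimeOverlapWtTower
import Summits.HubbardSuperconductivity.HubbardSuperconductivity.Theorems.KLProgrammeKLRegimeOverlapWtColFlowDeep
import Summits.HubbardSuperconductivity.HubbardSuperconductivity.Theorems.KLProgrammeKLRegimeSectorSliceGramSoftSharp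
import Summits.HubbardSuperconductivity.HubbardSuperconductivity.Theorems.KLProgrammeKLRegimeEngineV8DoorGfr

/-!
# K3 ENGINE child (stmt-HubbardSuperconductivity-20437 `KLRegimeEngineV17F2`), stub (b), the LEVELS package (ℓ): (I1′) ON THE FLOW FRAME `K_n`
# WITH THE FOUR BLOCK CONSTANTS DISCHARGED BY NAME — `κ` (k3c2-p3 `gram_sliceCT_bgmFat_sharp_klEng`), `α` (p3 `alphaWt_towerBlock_klEng_flow_deep`),
# `cr` (p3 `overlapWt_towerBlock_klEng_flow_deep`), `cc` (p3 `overlapWt_towerBlockCol_klEng_flow_deep`)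

Cell `gate-hubbard-kl`, seat p3 (g11), for E1 (r2d-p2, E1-LEVELS-BLUEPRINT-g8 (I1)/(I1′), §2 CONVENTION: block `k ≥ 1` of width `d`, covariance
`Γ_k = C^{K}_{(Λ_{d(k+1)}, Λ_{dk}]}`, input analysed at `F_{dk−1}` / `F̃_{dk−1}`, output family `F_{J′}`, `J′ ≥ dk`, read-out rate `j ≥ J′`).
`…EngineTowerBlockIncrWtRate.klWtPinnedSumAt_klTowerIncr_le` (E1) takes the Gram constant `κ` of `S(F̃_{dk−1})ᵀΓ_kS(F̃_{dk−1})`, its weighted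
row/column constant `α`, and the weighted overlap constants `cr, cc` of `E(F_{J′})·S(F̃_{dk−1})` as hypotheses.  On the flow frame `K := K_n` of a V17F2
history, under the REGISTERED v1 stub-(b) binder `U ≤ klEngU₀9 P R c` (`≤ klEngU₀4 ≤ klEngU₀3`, `≤ 1/(Gfr₃+1)` by …EngineV8DoorGfr), all four are theorems
of the tree; this file plugs them in:

* **`klWtPinnedSumAt_klTowerIncr_le_klEng (d d′)`** — `∃ Cκ Cb CJ CJ′ > 0` such that, for every admissible history (`HistP klPredsV17F2 … 0 n`,
  `FrameOK … K_n`, `1 ≤ n ≤ n_β + 1`), every block `k ≥ 1` with `2 ≤ dk`, `d(k+1) ≤ n_β + 1` on the deep window `4^{n+2}·U ≤ 4^{2(dk−1)+d′}`, every output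
  family `dk ≤ J′ ≤ n` and rate `j ≥ J′`, E1's born bound holds with
  `κ := √(Cκ·(Λ_{dk}/Λ_{dk−1})·e₀·8^{−(dk−1)})`, `α := Cb·(M/β)/Λ_{d(k+1)}`, `cr := 81·CJ·M/β`, `cc := 81·2^{J′−(dk−1)}·CJ′·M/β`
  (stated with equational binders `κ = …`, `α = …`, `cr = …`, `cc = …` so that the conclusion is E1's verbatim).
What stays hypothesis (E1's (I2)–(I6)): `Z^{K_n}_{Λ_{dk}} ≠ 0`, the weighted input sizes `B`, `ρ`, the ratio test `hθ`, `N₀`.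

Composition of landed theorems; no definitions; nothing about the model is asserted beyond them; nothing asserts superconductivity.
[cite: BenfattoGiulianiMastropietro2006, §2.7 (2.71a), §2.8 (2.77), (2.81)–(2.83), §3 (3.3)]
-/

noncomputable section

namespace Summit.HubbardSuperconductivity.HubbardSuperconductivity.Theorems.EngineV8

set_option linter.dupNamespace false -- summit = problem name (single-conjunct summit), D-0017

open Real Finset Literature.MathematicalPhysics.QuantumLattice Literature.Probability.LatticeModels GrassmannAlgebra
open Literature.MathematicalPhysics.QuantumLattice.BandSectorCounting
open Summit.HubbardSuperconductivity.HubbardSuperconductivity.Theorems.KLProgrammeLegKernels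
open Summit.HubbardSuperconductivity.HubbardSuperconductivity.Theorems.KLRegimeSplit
open Summit.HubbardSuperconductivity.HubbardSuperconductivity.Theorems.KLRegimeWick
open Summit.HubbardSuperconductivity.HubbardSuperconductivity.Theorems.TwoPointAssembly
open Summit.HubbardSuperconductivity.HubbardSuperconductivity.Theorems.TorusFourierL2
open Summit.HubbardSuperconductivity.HubbardSuperconductivity.Theorems.DispersionFlow
open Literature.Probability.LatticeModels.BattleFederbush

open Classical

/-- **(I1′) on the flow frame with the block constants discharged** (see the module docstring): E1's `klWtPinnedSumAt_klTowerIncr_le` at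
`K := klFlowFrameU L M β U μ n` with `κ, α, cr, cc` THE tree's constants (equational binders), under the v1 stub-(b) binder `U ≤ klEngU₀9 P R c`.
[cite: BenfattoGiulianiMastropietro2006, §2.7 (2.71a), §2.8 (2.77), (2.81)–(2.83), §3 (3.3)] -/
theorem klWtPinnedSumAt_klTowerIncr_le_klEng (d dd : ℕ) :
    ∃ Cκ Cb CJ CJ' : ℝ, 0 < Cκ ∧ 0 < Cb ∧ 0 < CJ ∧ 0 < CJ' ∧
      ∀ (G : GeoConsts) (P : SplitConsts) (R : RenConsts) (Q : EngConsts) (c : ℝ), P.WF → R.WF2 → 0 < c → c ≤ klEngC₃6 P R →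
      ∀ μ ∈ klWindowC, ∀ U : ℝ, 0 < U → U ≤ klEngU₀9 P R c →
      ∀ β : ℝ, klBetaMin ≤ β → β ≤ Real.exp (c / U ^ 2) →
      ∀ (L M : ℕ) [NeZero L] [NeZero M], klEngL₃ β U ≤ L → klEngM₃ β U L ≤ M →
      ∀ n : ℕ, 1 ≤ n → n ≤ nScales β + 1 →
        HistP klPredsV17F2 L M G P Q R β U μ 0 n → FrameOK R U (nScales β) μ (klFlowFrameU L M β U μ n) →
      ∀ k : ℕ, 1 ≤ d → 1 ≤ k → 2 ≤ d * k → d * (k + 1) ≤ nScales β + 1 →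
        (4 : ℝ) ^ (n + 2) * U ≤ (4 : ℝ) ^ (2 * (d * k - 1) + dd) →
      ∀ J' : ℕ, d * k ≤ J' → J' ≤ n → ∀ j : ℕ, J' ≤ j →
      ∀ κ α cr cc : ℝ,
        κ = Real.sqrt (Cκ * (klScale klE0 (d * k) / klScale klE0 (d * k - 1)) * (klE0 * ((8 : ℝ) ^ (d * k - 1))⁻¹)) →
        α = Cb * ((M : ℝ) / β) / klScale klE0 (d * (k + 1)) →
        cr = 81 * CJ * M / β → cc = 81 * (2 : ℝ) ^ (J' - (d * k - 1)) * CJ' * M / β →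
      hubbardEffPartitionFnCT L M β U μ 0 (klFlowFrameU L M β U μ n) (klScale klE0 (d * k)) ≠ 0 →
      ∀ B : ℕ → ℝ, (∀ m', 0 ≤ B m') →
        (∀ (m' : ℕ) (t : Fin (2 * m')) (w : SpaceTimeIdx L M × SectorLeg (sectorCount (d * k - 1))),
          ∑ Y ∈ univ.filter (fun Y : Fin (2 * m') → SpaceTimeIdx L M × SectorLeg (sectorCount (d * k - 1)) => Y t = w),
            klScaleWt L M β j ((univ.image Y).image (latticeLegPos (2 * (2 * M)))) *
              ‖kernel ℂ (ExteriorAlgebra.map (Matrix.toLin' (sectorAnalysisMatrix L M β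
                  (klAnisoFamily L M β μ (klFlowFrameU L M β U μ n) klE0 (d * k - 1))))
                (klTowerInput L M β U μ (klFlowFrameU L M β U μ n) d k)) (2 * m') Y‖ ≤ B m') →
      ∀ ρ : ℝ, 0 < ρ →
        Real.exp 1 * α * normV (SpaceTimeIdx L M × SectorLeg (sectorCount (d * k - 1))) κ ρ
          (fun m' => imagTimeWeight β M ^ (2 * m') * B m') / κ ^ 2 < 1 →
      ∀ N₀ : ℕ, 2 ≤ N₀ → ∀ (q : ℕ) (i : Fin (2 * (q + 1))) (w'' : SpaceTimeIdx L M × SectorLeg (sectorCount J')),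
      klWtPinnedSumAt L M β μ (klFlowFrameU L M β U μ n) J' j (2 * (q + 1))
          (klTowerIncr L M β U μ (klFlowFrameU L M β U μ n) d k) i w'' ≤
        imagTimeWeight β M ^ (2 * q + 1) *
          (cr * cc ^ (2 * q + 1) *
            (∑ n ∈ Ico 2 N₀, (ρ⁻¹ ^ (2 * q + 1 + 1) * κ⁻¹ ^ (2 * (n - 1)) * (α ^ (n - 1) * Real.exp n)) *
                ∑ δ ∈ (Fintype.piFinset fun _ : Fin n => range (Fintype.card (SpaceTimeIdx L M × SectorLeg (sectorCount (d * k - 1))) / 2 + 1)) with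
                    2 * q + 1 + 1 + 2 * (n - 1) ≤ ∑ a, 2 * δ a,
                  ∏ a, (Real.exp 2 * (κ + ρ)) ^ (2 * δ a) * (imagTimeWeight β M ^ (2 * δ a) * B (δ a)) +
              ρ⁻¹ ^ (2 * q + 1 + 1) *
                (Real.exp 1 * normV (SpaceTimeIdx L M × SectorLeg (sectorCount (d * k - 1))) κ ρ (fun m' => imagTimeWeight β M ^ (2 * m') * B m')) *
                (Real.exp 1 * α * normV (SpaceTimeIdx L M × SectorLeg (sectorCount (d * k - 1))) κ ρ
                    (fun m' => imagTimeWeight β M ^ (2 * m') * B m') / κ ^ 2) ^ (N₀ - 1) /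
                (1 - Real.exp 1 * α * normV (SpaceTimeIdx L M × SectorLeg (sectorCount (d * k - 1))) κ ρ
                    (fun m' => imagTimeWeight β M ^ (2 * m') * B m') / κ ^ 2)) +
          cr * cc ^ (2 * q + 1) *
            ∑ m' ∈ range (Fintype.card (SpaceTimeIdx L M × SectorLeg (sectorCount (d * k - 1))) / 2 + 1),
              (if q + 1 < m' then ((2 * m').choose (2 * (q + 1)) : ℝ) * κ ^ (2 * m' - 2 * (q + 1)) *
                (imagTimeWeight β M ^ (2 * m') * B m') else 0)) := by
  obtain ⟨Cκ, hCκ, hg⟩ := gram_sliceCT_bgmFat_sharp_klEng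
  obtain ⟨Cb, hCb, hαp⟩ := alphaWt_towerBlock_klEng_flow_deep d dd
  obtain ⟨CJ, hCJ, hrp⟩ := overlapWt_towerBlock_klEng_flow_deep d dd
  obtain ⟨CJ', hCJ', hcp⟩ := overlapWt_towerBlockCol_klEng_flow_deep d dd
  refine ⟨Cκ, Cb, CJ, CJ', hCκ, hCb, hCJ, hCJ', ?_⟩
  intro G P R Q c hP hR2 hc hc6 μ hμ U hU hU9 β hβmin hβc L M _ _ hL3 hM3 n hn1 hnN hhist hfr k hd hk hdk hdk1 hwin J' hJ' hJn j hj
    κ α cr cc hκ hα hcr hcc hZ B hB0 hB ρ hρ hθ N₀ hN₀ q i w''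
  have he : (0 : ℝ) < klE0 := by norm_num [klE0]
  have hβ : 0 < β := KLRegimeSplit.pos_of_klBetaMin_le hβmin
  have hM0 : (0 : ℝ) < M := Nat.cast_pos.2 (Nat.pos_of_ne_zero (NeZero.ne M))
  -- doors: the v1 binder `U ≤ klEngU₀9` is below every door the four packages ask
  have hU4 : U ≤ klEngU₀4 P R c := hU9.trans (klEngU₀9_le_klEngU₀4 P R c)
  have hU3g : U ≤ min (klEngU₀3 P R c) (1 / (R.Gfr 3 + 1)) :=
    le_min (hU9.trans (klEngU₀9_le_klEngU₀3 P R c)) (hU9.trans (klEngU₀9_le_inv_gfr_add_one P hR2.wf c (by norm_num)))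
  have hc3 : c ≤ klEngC₃3 P R := hc6.trans (klEngC₃6_le_klEngC₃3 P R)
  -- the overlap window `4ⁿ·U ≤ 4^{2dk+d′}` from the block window `4^{n+2}·U ≤ 4^{2(dk−1)+d′}`
  have hwin' : (4 : ℝ) ^ n * U ≤ (4 : ℝ) ^ (2 * (d * k) + dd) := by
    have h1 : (4 : ℝ) ^ n * U ≤ (4 : ℝ) ^ (n + 2) * U :=
      mul_le_mul_of_nonneg_right (pow_le_pow_right₀ (by norm_num) (by omega)) hU.le
    have h2 : (4 : ℝ) ^ (2 * (d * k - 1) + dd) ≤ (4 : ℝ) ^ (2 * (d * k) + dd) := pow_le_pow_right₀ (by norm_num) (by omega)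
    exact h1.trans (hwin.trans h2)
  set K : TrigPolyC4v := klFlowFrameU L M β U μ n with hKdef
  -- κ: the Gram constant of the thick block (k3c2-p3), family index `dk − 1 = (dk − 2) + 1`
  have hgram : ∀ m' : ℕ, 1 ≤ m' → m' ≤ nScales β + 1 → ∀ Λ Λ' : ℝ, 0 < Λ → Λ ≤ Λ' → Λ' ≤ klScale klE0 m' →
      IsGramBoundedR ((sectorSubMatrix L M β (bgmFatMultiplier L M klE0 β (nambuXiCT L μ K) m')).transpose *
          hubbardCovSliceCT L M β μ 0 K Λ Λ' * sectorSubMatrix L M β (bgmFatMultiplier L M klE0 β (nambuXiCT L μ K) m'))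
        (Real.sqrt (Cκ * (Λ' / klScale klE0 m') * (klE0 * ((8 : ℝ) ^ m')⁻¹))) := by
    intro m' h1 h2 Λ Λ' hΛ hΛΛ' hΛ'
    obtain ⟨m, rfl⟩ : ∃ m, m' = m + 1 := ⟨m' - 1, by omega⟩
    exact (hg P R c hP hR2 hc hc3 μ hμ U hU hU4 β hβmin hβc K hfr L M hL3 hM3 m (by omega) Λ Λ' hΛ hΛΛ' hΛ').2.1
  have hΛpos : 0 < klScale klE0 (d * (k + 1)) := klth_klScale_pos _
  have hdkle : d * k ≤ d * (k + 1) := Nat.mul_le_mul_left d (Nat.le_succ k)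
  have hΛle : klScale klE0 (d * (k + 1)) ≤ klScale klE0 (d * k) := klScale_le_klScale he.le hdkle
  have hΛle' : klScale klE0 (d * k) ≤ klScale klE0 (d * k - 1) := klScale_le_klScale he.le (by omega)
  have hGB := hgram (d * k - 1) (by omega) (by omega) (klScale klE0 (d * (k + 1))) (klScale klE0 (d * k)) hΛpos hΛle hΛle'
  have hκpos : 0 < κ := by
    rw [hκ]
    have h1 : 0 < klScale klE0 (d * k) := klth_klScale_pos _
    have h2 : 0 < klScale klE0 (d * k - 1) := klth_klScale_pos _
    exact Real.sqrt_pos.2 (by positivity)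
  -- α: the block's weighted rows/columns (p3)
  obtain ⟨hrow, hcol⟩ := hαp G P R Q c hR2 hc hc6 μ hμ U hU hU3g β hβmin hβc L M hL3 hM3 n hn1 hnN hhist hfr k hk hdk hdk1 hwin j (hJ'.trans hj)
  have hαpos : 0 < α := by rw [hα]; positivity
  -- cr, cc: the weighted overlap constants (p3)
  have hrow' := (hrp G P R Q c hR2 hc hc6 μ hμ U hU hU3g β hβmin hβc L M hL3 hM3 n hn1 hnN hhist hfr k (by omega) J' hJ' hJn hwin' j hj).1
  have hcol' := hcp G P R Q c hR2 hc hc6 μ hμ U hU hU3g β hβmin hβc L M hL3 hM3 n hn1 hnN hhist hfr k (by omega) J' hJ' hJn hwin' j hj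
  have hcc0 : 0 ≤ cc := by rw [hcc]; positivity
  subst hκ hα hcr hcc
  exact klWtPinnedSumAt_klTowerIncr_le hβ U μ K j hd hk hJ' hZ hκpos hGB B hB0 hB hαpos hrow hcol hρ hθ hcc0 hrow' hcol' hN₀ q i w''

end Summit.HubbardSuperconductivity.HubbardSuperconductivity.Theorems.EngineV8

end
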